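import Summits.MatrixMultiplication.MatrixMultiplication.Theorems.AbelianSTPPCensusShapeCertVPFinal
import Summits.MatrixMultiplication.MatrixMultiplication.Theorems.AbelianSTPPCensusShapeCertVPEvalA
import Summits.MatrixMultiplication.MatrixMultiplication.Theorems.AbelianSTPPCensusShapeCertVPEvalB
import Summits.MatrixMultiplication.MatrixMultiplication.Theorems.AbelianSTPPCensusShapeCertVPEvalC
import Summits.MatrixMultiplication.MatrixMultiplication.Theorems.AbelianSTPPCensusShapeCertVPEvalD
import Summits.MatrixMultiplication.MatrixMultiplication.Theorems.AbelianSTPPCensusShapeCertVPEvalE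
import Summits.MatrixMultiplication.MatrixMultiplication.Theorems.AbelianSTPPCensusShapeCertVPEvalF
import Summits.MatrixMultiplication.MatrixMultiplication.Theorems.AbelianSTPPCensusShapeCertVPEvalG
import Summits.MatrixMultiplication.MatrixMultiplication.Theorems.AbelianSTPPCensusShapeCertVPEvalH
import Summits.MatrixMultiplication.MatrixMultiplication.Theorems.AbelianSTPPCensusShapeCertVPEvalI
import Summits.MatrixMultiplication.MatrixMultiplication.Theorems.AbelianSTPPCensusShapeCertVPEvalJ
import Summits.MatrixMultiplication.MatrixMultiplication.Theorems.AbelianSTPPCensusVPUpTo127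
import Summits.MatrixMultiplication.MatrixMultiplication.Theses.AbelianSTPPCensusVP

/-!
# Route `AbelianSTPPCensusVP` — crux `ShapeExclusionVP337` (stmt-MatrixMultiplication-19191), closing file

**vP shape exclusion for `T_E` (`τ = 5/2`) at every order `M ≤ 337`**: no shape list with at least two members that
satisfies the vP sieve system (`SieveAdmissibleVP` = the vM sieve rules + U11-G + U11-P) has value
`Σ_i (a_i b_i c_i)^((5/2)/3) > M`.  Cell mm-stpp, seat mm-stpp-theory (gen 6).

Assembly of three kernel-checked ranges:
* `M ≤ 127` — `AbelianSTPPCensusVP.shapeExclusionVP_upTo_127` (landed, p427389: the vM certificate `ShapeCert` plus the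
  eleven U11-G residual kills);
* `128 ≤ M ≤ 337` — the vP certificate checker `ShapeCertVP.checkV` (`…ShapeCertVPDefs`; soundness
  `ShapeCertVP.checkV_sound` in `…ShapeCertVPSearch`, bridge `ShapeCertVP.shapeExclusionVP_of_checkV` in
  `…ShapeCertVPFinal`), evaluated by the kernel (`decide +kernel`, standard axioms, no `native_decide`) at each of the
  210 orders in `…ShapeCertVPEvalA`–`J` and collected here (`ShapeCertVP.checkV_all`).
The two registered stubs of the crux skeleton (`stub_vp_128_207`, `stub_vp_208_337`, birth line v2) are proved as
stated, and `ShapeExclusionVP337_proof` concludes the route declaration BY NAME.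
WHAT THIS IS NOT: no statement about orders `≥ 338` (the certificate is false at 338: a beating vP-admissible list
exists there, REF [93]), no STPP family, no `ω` statement.
-/

set_option linter.dupNamespace false -- `MatrixMultiplication.MatrixMultiplication` (summit = problem, D-0017)
set_option autoImplicit false

namespace Summit.MatrixMultiplication.MatrixMultiplication.Theorems

/-- **The vP certificate holds at every order `128 ≤ M ≤ 337`** (the ten kernel-evaluated ranges). -/
theorem ShapeCertVP.checkV_all (M : ℕ) (h₁ : 128 ≤ M) (h₂ : M ≤ 337) : ShapeCertVP.checkV M = true := by
  rcases Nat.lt_or_ge M 164 with k0 | g0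
  · exact ShapeCertVP.checkV_128_163 M h₁ (by omega)
  rcases Nat.lt_or_ge M 200 with k1 | g1
  · exact ShapeCertVP.checkV_164_199 M g0 (by omega)
  rcases Nat.lt_or_ge M 230 with k2 | g2
  · exact ShapeCertVP.checkV_200_229 M g1 (by omega)
  rcases Nat.lt_or_ge M 255 with k3 | g3
  · exact ShapeCertVP.checkV_230_254 M g2 (by omega)
  rcases Nat.lt_or_ge M 280 with k4 | g4
  · exact ShapeCertVP.checkV_255_279 M g3 (by omega)
  rcases Nat.lt_or_ge M 300 with k5 | g5
  · exact ShapeCertVP.checkV_280_299 M g4 (by omega)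
  rcases Nat.lt_or_ge M 310 with k6 | g6
  · exact ShapeCertVP.checkV_300_309 M g5 (by omega)
  rcases Nat.lt_or_ge M 318 with k7 | g7
  · exact ShapeCertVP.checkV_310_317 M g6 (by omega)
  rcases Nat.lt_or_ge M 326 with k8 | g8
  · exact ShapeCertVP.checkV_318_325 M g7 (by omega)
  · exact ShapeCertVP.checkV_326_337 M g8 h₂

/-- **Stub 1 of the crux skeleton** (birth line v2): vP shape exclusion for `T_E` at the orders `128–207`. -/
theorem AbelianSTPPCensusVP.stub_vp_128_207 : ∀ (N M : ℕ) (a b c : Fin N → ℕ), 2 ≤ N → 128 ≤ M → M ≤ 207 →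
    SieveAdmissibleVP M a b c → ¬ Beats (5 / 2) M a b c :=
  fun N M a b c hN h₁ h₂ =>
    ShapeCertVP.shapeExclusionVP_of_checkV (by omega) (ShapeCertVP.checkV_all M h₁ (by omega)) N a b c hN

/-- **Stub 2 of the crux skeleton** (birth line v2, the hardest): vP shape exclusion for `T_E` at the orders `208–337`. -/
theorem AbelianSTPPCensusVP.stub_vp_208_337 : ∀ (N M : ℕ) (a b c : Fin N → ℕ), 2 ≤ N → 208 ≤ M → M ≤ 337 →
    SieveAdmissibleVP M a b c → ¬ Beats (5 / 2) M a b c :=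
  fun N M a b c hN h₁ h₂ =>
    ShapeCertVP.shapeExclusionVP_of_checkV h₂ (ShapeCertVP.checkV_all M (by omega) h₂) N a b c hN

/-- **Crux `ShapeExclusionVP337` of route `AbelianSTPPCensusVP`, proved**: vP shape exclusion for `T_E` (`τ = 5/2`) at
every order `M ≤ 337` — the route declaration by name. -/
theorem ShapeExclusionVP337_proof :
    Summit.MatrixMultiplication.MatrixMultiplication.Theses.AbelianSTPPCensusVP.ShapeExclusionVP337 := by
  unfold Summit.MatrixMultiplication.MatrixMultiplication.Theses.AbelianSTPPCensusVP.ShapeExclusionVP337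
  intro N M a b c hN hM hadm
  rcases Nat.lt_or_ge M 128 with h | h
  · exact AbelianSTPPCensusVP.shapeExclusionVP_upTo_127 N M a b c hN (by omega) hadm
  · rcases Nat.lt_or_ge M 208 with k | k
    · exact AbelianSTPPCensusVP.stub_vp_128_207 N M a b c hN h (by omega) hadm
    · exact AbelianSTPPCensusVP.stub_vp_208_337 N M a b c hN k hM hadm

end Summit.MatrixMultiplication.MatrixMultiplication.Theorems
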